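import Summits.Ventures.PercRepro.ThetaOmegaGraphSymm
import Summits.Ventures.PercRepro.ThetaOmegaGraphMono

/-!
# The pentagon form: an unconditional linear lower bound

Addendum 85 supplement 2 (mine-1, gen 46). Row C-050 (PENT) asks for `|F|` counted sets for every
family with two labellings into the pentagon relation on `ZMod 5`. The theorem (Ω) of gen 43
settles every instance that leaves a label unused (`card_le_omegaCountR_pent_of_unused`: the four
remaining labels split into two cliques). Deleting, for each label `v`, the members carrying `v`
on either slot leaves such an instance; every member survives at least three of the five
deletions; and the count is monotone in the family. Hence

* `three_mul_card_le_five_mul_omegaCountR_pent` — **`3 |F| ≤ 5 · count` for every pentagon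
  instance with at least three members, on every ground set** — the first unconditional bound for
  (PENT) at all sizes (the conjecture asks for `5 |F| ≤ 5 · count`).
-/

namespace PercRepro.MSTight

open Finset

variable {α : Type*} [DecidableEq α] {U : Finset α} {F : Finset (Finset α)}
  {l0 l1 : Finset α → ZMod 5}

/-- The members of `F` carrying the label `v` on neither slot. -/
def pentAvoid (F : Finset (Finset α)) (l0 l1 : Finset α → ZMod 5) (v : ZMod 5) :
    Finset (Finset α) :=
  F.filter fun s => l0 s ≠ v ∧ l1 s ≠ v

/-- The pentagon count of a family of at least three members is at least three. -/
theorem three_le_omegaCountR_pent (hF : ∀ s ∈ F, s ⊆ U) (h3 : 3 ≤ F.card) :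
    3 ≤ omegaCountR pentR U F l0 l1 := by
  obtain ⟨F', hF'F, hF'3⟩ := exists_subset_card_eq h3
  have h := card_le_omegaCountR_of_card_eq_three (R := pentR) (l0 := l0) (l1 := l1)
    pentR_symmetric pentR_tripleRel (fun x hx => hF x (hF'F hx)) hF'3
  rw [hF'3] at h
  exact le_trans h (omegaCountR_mono hF'F)

/-- **Deleting a label**: the members avoiding the label `v` number at most the pentagon count of
the whole family. -/
theorem card_pentAvoid_le (hF : ∀ s ∈ F, s ⊆ U) (h3 : 3 ≤ F.card) (v : ZMod 5) :
    (pentAvoid F l0 l1 v).card ≤ omegaCountR pentR U F l0 l1 := by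
  have hsub : pentAvoid F l0 l1 v ⊆ F := filter_subset _ _
  rcases le_or_gt 3 (pentAvoid F l0 l1 v).card with hge | hlt
  · have h := card_le_omegaCountR_pent_of_unused (l0 := l0) (l1 := l1)
      (fun s hs => hF s (hsub hs)) hge v (fun s hs => (mem_filter.1 hs).2)
    exact le_trans h (omegaCountR_mono hsub)
  · exact le_trans (le_of_lt hlt) (three_le_omegaCountR_pent (l0 := l0) (l1 := l1) hF h3)

/-- Every member avoids at least three of the five labels. -/
theorem three_le_card_avoiding (a b : ZMod 5) :
    3 ≤ (Finset.univ.filter fun v : ZMod 5 => a ≠ v ∧ b ≠ v).card := by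
  have h : (Finset.univ \ {a, b} : Finset (ZMod 5)) ⊆
      Finset.univ.filter fun v : ZMod 5 => a ≠ v ∧ b ≠ v := by
    intro v hv
    rw [mem_sdiff, mem_insert, mem_singleton, not_or] at hv
    exact mem_filter.2 ⟨mem_univ v, fun h => hv.2.1 h.symm, fun h => hv.2.2 h.symm⟩
  refine le_trans ?_ (card_le_card h)
  rw [card_sdiff_of_subset (subset_univ _), card_univ, ZMod.card]
  have : ({a, b} : Finset (ZMod 5)).card ≤ 2 := card_le_two
  omega

/-- **The pentagon form is true up to the factor `3 / 5`**: for every family of at least three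
members with two labellings into the pentagon relation, on every ground set,
`3 |F| ≤ 5 · count`. -/
theorem three_mul_card_le_five_mul_omegaCountR_pent (hF : ∀ s ∈ F, s ⊆ U) (h3 : 3 ≤ F.card) :
    3 * F.card ≤ 5 * omegaCountR pentR U F l0 l1 := by
  -- the double count: `∑ v, |pentAvoid v| = ∑ s ∈ F, #{v : s avoids v} ≥ 3 |F|`
  have hsum : 3 * F.card ≤ ∑ v : ZMod 5, (pentAvoid F l0 l1 v).card := by
    have h1 : ∑ v : ZMod 5, (pentAvoid F l0 l1 v).card =
        ∑ s ∈ F, (Finset.univ.filter fun v : ZMod 5 => l0 s ≠ v ∧ l1 s ≠ v).card := by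
      simp only [pentAvoid, card_filter]
      rw [sum_comm]
    rw [h1]
    calc 3 * F.card = ∑ _s ∈ F, 3 := by rw [sum_const, smul_eq_mul, mul_comm]
      _ ≤ ∑ s ∈ F, (Finset.univ.filter fun v : ZMod 5 => l0 s ≠ v ∧ l1 s ≠ v).card :=
        sum_le_sum fun s _ => three_le_card_avoiding (l0 s) (l1 s)
  refine le_trans hsum ?_
  calc ∑ v : ZMod 5, (pentAvoid F l0 l1 v).card
      ≤ ∑ _v : ZMod 5, omegaCountR pentR U F l0 l1 :=
        sum_le_sum fun v _ => card_pentAvoid_le hF h3 v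
    _ = 5 * omegaCountR pentR U F l0 l1 := by
        rw [sum_const, card_univ, ZMod.card, smul_eq_mul]

end PercRepro.MSTight
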